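import Mathlib.Analysis.Calculus.Deriv.MeanValue
import Mathlib.Analysis.Calculus.Deriv.Inv
import Mathlib.Analysis.SpecialFunctions.Sqrt
import Summits.HubbardSuperconductivity.HubbardSuperconductivity.Theorems.AnisotropyChordSpinMonotoneTwoMagnonRookWeightedCriterion

/-!
# Route `AnisotropyChord`: THEOREM R (weighted rook graphs) — analytic form: the flat overlap is
# antitone in the coupling along the positive solution branch

THEOREM R (theory seat `hubbard-h0-rotor-theory-1`, ROTOR-THEORY-5 §41) as real analysis: for real
`p, q ≥ 1` and coupling ratio `0 < J < 1` (`J₁ = 1 ≠ J₂ = J`; the equal-weight case is the tree theorem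
`rook_twoMagnon_condensate_monotone`), a *physical point* at coupling `σ = 1 - Δ > 0` is a positive
solution `(u, v, E)` of the three-class eigen-equations (E1) `u (J q + σ - E) = J q`,
(E2) `v (p + σ J - E) = p`, (E3) `E = (1 - v) + J (1 - u)`; its flat overlap is
`W(u,v) = (pu + qv + pq)² / ((p + q + pq)(pu² + qv² + pq))`.
**Theorem** (`wrook_flatOverlap_antitone`): physical points at `0 < σ₁ ≤ σ₂` satisfy
`W(u₂,v₂) ≤ W(u₁,v₁)`.  Proof: eliminating `σ, E` (`wrook_point_relations`), `v` is the unique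
positive root (`wrook_posRoot_unique`) of `(1-J) v² + β(u) v - p`, `β(u) = c₀ + J²q/u + J(1-J)u`,
`c₀ = p - (1-J) - J²q - J(1-J)`, i.e. the explicit branch `v(u) = (-β + √(β² + 4(1-J)p))/(2(1-J))`
(`wrook_branch_basic`), and `σ = σ(u) = J(1-u) + (1 - v(u)) + Jq/u - Jq`.  Along the branch
`v′ = -β′v/√R` (`wrook_branch_hasDerivAt`); the derivative of `g(u) = W(u, v(u))` is a positive
multiple of `X + v′Y`, and `u² v √R (X + v′Y) = J·T` (`wrook_dir_nonneg`) with `T ≥ 0` the core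
inequality `wrook_criterion_nonneg`, so `g` is monotone on `(0,1)` (`wrook_overlap_hasDerivAt`);
`σ′ < 0` because `√R·v = (1-J)v² + p` (`wrook_sigma_hasDerivAt`), so `σ` is strictly antitone on
`(0,1]` with `σ(1) = 0` (`wrook_sigma_strictAnti`).  Hence `σ₁ ≤ σ₂` forces `u₂ ≤ u₁` and the claim
(mean value theorem).  Functions are passed with their defining equations as hypotheses: no
definition is introduced; nothing here mentions graphs (the two-magnon wrapper over
`xxzHamiltonianWith` on `K_m □ K_n` — Perron, class reduction — is the remaining routine port).
-/


set_option linter.dupNamespace false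

namespace Summit.HubbardSuperconductivity.HubbardSuperconductivity.Theorems.AnisotropyChord.TwoMagnon

/-- Elimination of `σ, E` at a physical point of the weighted rook quotient: from (E1)–(E3) with
`u > 0`, the class value `v` is a root of `(1-J)v² + β(u)v - p` with
`β(u) = (p - (1-J) - J²q - J(1-J)) + J²q/u + J(1-J)u`, and `σ = J(1-u) + (1-v) + Jq/u - Jq`. [folklore] -/
theorem wrook_point_relations {p q J σ E u v : ℝ} (hu : 0 < u)
    (e1 : u * (J * q + σ - E) = J * q) (e2 : v * (p + σ * J - E) = p)
    (e3 : E = (1 - v) + J * (1 - u)) :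
    (1 - J) * v ^ 2 + ((p - (1 - J) - J ^ 2 * q - J * (1 - J)) + J ^ 2 * q / u + J * (1 - J) * u) * v
        - p = 0 ∧
      σ = J * (1 - u) + (1 - v) + J * q / u - J * q := by
  have hu0 : u ≠ 0 := hu.ne'
  have hσ : σ = E + J * q / u - J * q := by
    have h1 : u * (σ - E) = J * q - J * q * u := by linear_combination e1
    field_simp
    linear_combination h1
  refine ⟨?_, by rw [hσ, e3]; ring⟩
  rw [hσ, e3] at e2
  field_simp at e2
  field_simp
  linear_combination e2

/-- Uniqueness of the positive root of `(1-J)X² + bX - p` for `J < 1`, `p > 0`. [folklore] -/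
theorem wrook_posRoot_unique {J p b v w : ℝ} (hJ1 : J < 1) (hp : 0 < p) (hv : 0 < v) (hw : 0 < w)
    (hv0 : (1 - J) * v ^ 2 + b * v - p = 0) (hw0 : (1 - J) * w ^ 2 + b * w - p = 0) : v = w := by
  have h1 : (v - w) * ((1 - J) * (v + w) + b) = 0 := by linear_combination hv0 - hw0
  have h4 : 0 < (1 - J) * w + b := by
    by_contra h
    nlinarith [mul_nonneg hw.le (neg_nonneg.mpr (le_of_not_gt h))]
  have h2 : 0 < (1 - J) * (v + w) + b := by nlinarith [mul_pos (sub_pos.mpr hJ1) hv]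
  rcases mul_eq_zero.mp h1 with h | h
  exacts [by linarith, absurd h h2.ne']

/-- The explicit positive branch `v(u) = (-β(u) + √R(u))/(2(1-J))`, `R = β² + 4(1-J)p`:
`R > 0`, `√R > 0`, `v > 0`, `2(1-J)v + β = √R`, and `v` solves `(1-J)v² + βv - p = 0`
(the functions are passed with their defining equations). [folklore] -/
theorem wrook_branch_basic {p J : ℝ} (hJ1 : J < 1) (hp0 : 0 < p) (β R vf : ℝ → ℝ)
    (hR : ∀ u, R u = β u ^ 2 + 4 * (1 - J) * p)
    (hvf : ∀ u, vf u = (-β u + Real.sqrt (R u)) / (2 * (1 - J))) (u : ℝ) :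
    0 < R u ∧ 0 < Real.sqrt (R u) ∧ 0 < vf u ∧ 2 * (1 - J) * vf u + β u = Real.sqrt (R u) ∧
      (1 - J) * vf u ^ 2 + β u * vf u - p = 0 := by
  have hJ' : 0 < 1 - J := sub_pos.mpr hJ1
  have hRpos : 0 < R u := by rw [hR]; nlinarith [sq_nonneg (β u), mul_pos hJ' hp0]
  have hsq : Real.sqrt (R u) ^ 2 = R u := Real.sq_sqrt hRpos.le
  have hspos : 0 < Real.sqrt (R u) := Real.sqrt_pos.mpr hRpos
  have hβlt : β u < Real.sqrt (R u) := by
    refine lt_of_le_of_lt (le_abs_self _) ?_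
    rw [← Real.sqrt_sq_eq_abs]
    exact Real.sqrt_lt_sqrt (sq_nonneg _) (by rw [hR]; nlinarith [mul_pos hJ' hp0])
  have hvpos : 0 < vf u := by rw [hvf]; exact div_pos (by linarith) (by linarith)
  have hΦv : 2 * (1 - J) * vf u + β u = Real.sqrt (R u) := by rw [hvf]; field_simp; ring
  refine ⟨hRpos, hspos, hvpos, hΦv, ?_⟩
  have hsq' : Real.sqrt (R u) ^ 2 = β u ^ 2 + 4 * (1 - J) * p := by rw [hsq, hR]
  have hJne : (1 : ℝ) - J ≠ 0 := hJ'.ne'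
  have e : (1 - J) * vf u ^ 2 + β u * vf u - p
      = (Real.sqrt (R u) ^ 2 - (β u ^ 2 + 4 * (1 - J) * p)) / (4 * (1 - J)) := by
    rw [hvf]; field_simp; ring
  rw [e, hsq', sub_self, zero_div]

/-- Derivative of the branch: `v′(u) = -β′(u) v(u)/√R(u)` with `β′(u) = J(1-J) - J²q/u²`
(`u ≠ 0`; chain rule through `√·`, then `2(1-J)v + β = √R`). [folklore] -/
theorem wrook_branch_hasDerivAt {p q J : ℝ} (hJ1 : J < 1) (hp0 : 0 < p) (β R vf : ℝ → ℝ)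
    (hβ : ∀ u, β u = (p - (1 - J) - J ^ 2 * q - J * (1 - J)) + J ^ 2 * q / u + J * (1 - J) * u)
    (hR : ∀ u, R u = β u ^ 2 + 4 * (1 - J) * p)
    (hvf : ∀ u, vf u = (-β u + Real.sqrt (R u)) / (2 * (1 - J))) {u : ℝ} (hu : u ≠ 0) :
    HasDerivAt vf (-((J * (1 - J) - J ^ 2 * q / u ^ 2) * vf u) / Real.sqrt (R u)) u := by
  have hJ' : 0 < 1 - J := sub_pos.mpr hJ1
  obtain ⟨hRpos, hspos, _, hΦv, _⟩ := wrook_branch_basic hJ1 hp0 β R vf hR hvf u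
  set c₀ : ℝ := p - (1 - J) - J ^ 2 * q - J * (1 - J) with hc₀
  set b' : ℝ := J ^ 2 * q * (-(u ^ 2)⁻¹) + J * (1 - J) with hb'
  have hβd : HasDerivAt β b' u := by
    have h1 : HasDerivAt (fun u : ℝ => u⁻¹) (-(u ^ 2)⁻¹) u := hasDerivAt_inv hu
    have h2 := ((h1.const_mul (J ^ 2 * q)).const_add c₀).add ((hasDerivAt_id u).const_mul (J * (1 - J)))
    have hfun : β = fun u : ℝ => c₀ + J ^ 2 * q * u⁻¹ + J * (1 - J) * id u := by
      funext x; rw [hβ x]; simp only [id, div_eq_mul_inv]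
    rw [hfun]
    refine h2.congr_deriv ?_
    simp only [hb', mul_one]
  have hRd : HasDerivAt R (2 * β u * b') u := by
    have h := (hβd.pow 2).add_const (4 * (1 - J) * p)
    have hfun : R = fun x => β x ^ 2 + 4 * (1 - J) * p := funext hR
    rw [hfun]
    refine h.congr_deriv ?_
    simp only [Nat.cast_ofNat]; ring
  have hsd : HasDerivAt (fun u => Real.sqrt (R u)) (2 * β u * b' / (2 * Real.sqrt (R u))) u :=
    hRd.sqrt hRpos.ne'
  have h := ((hβd.neg.add hsd).div_const (2 * (1 - J)))
  have hfun : vf = fun x => (-β x + Real.sqrt (R x)) / (2 * (1 - J)) := funext hvf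
  rw [hfun]
  refine h.congr_deriv ?_
  have hs := hspos.ne'
  have hJne : (1 : ℝ) - J ≠ 0 := hJ'.ne'
  have hb'' : J * (1 - J) - J ^ 2 * q / u ^ 2 = b' := by
    simp only [hb']; field_simp; ring
  beta_reduce
  rw [hb'']
  field_simp
  ring

/-- Sign of the directional factor: at a point of the branch (`s := 2(1-J)v + β(u) > 0`,
`(1-J)v² + β(u)v = p`) where the criterion `T ≥ 0` holds, `X + v′·Y ≥ 0` with `v′ = -β′v/s`,
`X = v(v-u) + p(1-u)`, `Y = u(u-v) + q(1-v)`: indeed `u² v s (X + v′Y) = J·T + uX·(uΦ) = J·T`.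
[folklore] -/
theorem wrook_dir_nonneg {p q J u v : ℝ} (hJ : 0 < J) (hu : 0 < u) (hv : 0 < v)
    (hs : 0 < 2 * (1 - J) * v + ((p - (1 - J) - J ^ 2 * q - J * (1 - J)) + J ^ 2 * q / u
      + J * (1 - J) * u))
    (hr : (1 - J) * v ^ 2 + ((p - (1 - J) - J ^ 2 * q - J * (1 - J)) + J ^ 2 * q / u
      + J * (1 - J) * u) * v - p = 0)
    (hT : 0 ≤ (u ^ 2 / J) * (p + (1 - J) * v ^ 2) * (v * (v - u) + p * (1 - u))
        + v ^ 2 * (J * q + (J - 1) * u ^ 2) * (u * (u - v) + q * (1 - v))) :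
    0 ≤ (v * (v - u) + p * (1 - u))
      + (-((J * (1 - J) - J ^ 2 * q / u ^ 2) * v) / (2 * (1 - J) * v
        + ((p - (1 - J) - J ^ 2 * q - J * (1 - J)) + J ^ 2 * q / u + J * (1 - J) * u)))
        * (u * (u - v) + q * (1 - v)) := by
  have hu0 : u ≠ 0 := hu.ne'
  have hJ0 : J ≠ 0 := hJ.ne'
  set S : ℝ := 2 * (1 - J) * v + ((p - (1 - J) - J ^ 2 * q - J * (1 - J)) + J ^ 2 * q / u
      + J * (1 - J) * u) with hS
  set B : ℝ := J * (1 - J) - J ^ 2 * q / u ^ 2 with hB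
  have hS0 : S ≠ 0 := hs.ne'
  have e1 : (v * (v - u) + p * (1 - u)) + (-(B * v) / S) * (u * (u - v) + q * (1 - v))
      = (S * (v * (v - u) + p * (1 - u)) - B * v * (u * (u - v) + q * (1 - v))) / S := by
    field_simp
    ring
  rw [e1]
  apply div_nonneg _ hs.le
  have key : u ^ 2 * v * (S * (v * (v - u) + p * (1 - u)) - B * v * (u * (u - v) + q * (1 - v)))
      = J * ((u ^ 2 / J) * (p + (1 - J) * v ^ 2) * (v * (v - u) + p * (1 - u))
        + v ^ 2 * (J * q + (J - 1) * u ^ 2) * (u * (u - v) + q * (1 - v)))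
        + u * (v * (v - u) + p * (1 - u))
          * (u * ((1 - J) * v ^ 2 + ((p - (1 - J) - J ^ 2 * q - J * (1 - J)) + J ^ 2 * q / u
            + J * (1 - J) * u) * v - p)) := by
    rw [hS, hB]
    field_simp
    ring
  rw [hr, mul_zero, mul_zero, add_zero] at key
  have hpos : 0 < u ^ 2 * v := by positivity
  have h2 : 0 ≤ u ^ 2 * v * (S * (v * (v - u) + p * (1 - u)) - B * v * (u * (u - v) + q * (1 - v))) := by
    rw [key]; exact mul_nonneg hJ.le hT
  exact (mul_nonneg_iff_of_pos_left hpos).mp h2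

/-- The flat overlap along the branch, `g(u) = W(u, v(u))`, has a nonnegative derivative at every
`u ∈ (0,1)` with `σ(u) > 0`: quotient rule, the numerator is `2pq(p+q+pq)·S₁·(X + v′Y)`, and
`X + v′Y ≥ 0` by `wrook_dir_nonneg` fed with `wrook_criterion_nonneg` at the branch point. [folklore] -/
theorem wrook_overlap_hasDerivAt {p q J : ℝ} (hp : 1 ≤ p) (hq : 1 ≤ q) (hJ : 0 < J) (hJ1 : J < 1)
    (β R vf g : ℝ → ℝ)
    (hβ : ∀ u, β u = (p - (1 - J) - J ^ 2 * q - J * (1 - J)) + J ^ 2 * q / u + J * (1 - J) * u)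
    (hR : ∀ u, R u = β u ^ 2 + 4 * (1 - J) * p)
    (hvf : ∀ u, vf u = (-β u + Real.sqrt (R u)) / (2 * (1 - J)))
    (hg : ∀ u, g u = (p * u + q * vf u + p * q) ^ 2 /
      ((p + q + p * q) * (p * u ^ 2 + q * vf u ^ 2 + p * q)))
    {u : ℝ} (hu0 : 0 < u)
    (hσ : 0 < J * (1 - u) + (1 - vf u) + J * q / u - J * q) :
    ∃ g' : ℝ, HasDerivAt g g' u ∧ 0 ≤ g' := by
  have hp0 : 0 < p := by linarith
  have hq0 : 0 < q := by linarith
  have hune : u ≠ 0 := hu0.ne'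
  obtain ⟨_, hspos, hvpos, hΦv, hroot⟩ := wrook_branch_basic hJ1 hp0 β R vf hR hvf u
  have hv' := wrook_branch_hasDerivAt hJ1 hp0 β R vf hβ hR hvf hune
  set vd : ℝ := -((J * (1 - J) - J ^ 2 * q / u ^ 2) * vf u) / Real.sqrt (R u) with hvd
  have hDpos : 0 < (p + q + p * q) * (p * u ^ 2 + q * vf u ^ 2 + p * q) := by positivity
  have hN : HasDerivAt (fun u => (p * u + q * vf u + p * q) ^ 2)
      (2 * (p * u + q * vf u + p * q) * (p + q * vd)) u := by
    have ha : HasDerivAt (fun u : ℝ => p * u) p u := by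
      simpa using (hasDerivAt_id u).const_mul p
    have h1 : HasDerivAt (fun u => p * u + q * vf u + p * q) (p + q * vd) u :=
      (ha.add (hv'.const_mul q)).add_const (p * q)
    refine (h1.pow 2).congr_deriv ?_
    simp only [Nat.cast_ofNat]; ring
  have hD : HasDerivAt (fun u => (p + q + p * q) * (p * u ^ 2 + q * vf u ^ 2 + p * q))
      ((p + q + p * q) * (2 * p * u + 2 * q * vf u * vd)) u := by
    have ha : HasDerivAt (fun u : ℝ => p * u ^ 2) (p * (2 * u)) u := by
      simpa using ((hasDerivAt_id u).pow 2).const_mul p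
    have hb : HasDerivAt (fun u => q * vf u ^ 2) (q * (2 * vf u * vd)) u := by
      refine ((hv'.pow 2).const_mul q).congr_deriv ?_
      simp only [Nat.cast_ofNat]; ring
    refine (((ha.add hb).add_const (p * q)).const_mul (p + q + p * q)).congr_deriv ?_
    ring
  have hG := hN.fun_div hD hDpos.ne'
  have hfun : g = fun u => (p * u + q * vf u + p * q) ^ 2 /
      ((p + q + p * q) * (p * u ^ 2 + q * vf u ^ 2 + p * q)) := funext hg
  refine ⟨_, by rw [hfun]; exact hG, ?_⟩
  apply div_nonneg _ (sq_nonneg _)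
  have key : 2 * (p * u + q * vf u + p * q) * (p + q * vd)
        * ((p + q + p * q) * (p * u ^ 2 + q * vf u ^ 2 + p * q))
      - (p * u + q * vf u + p * q) ^ 2 * ((p + q + p * q) * (2 * p * u + 2 * q * vf u * vd))
      = 2 * p * q * (p + q + p * q) * (p * u + q * vf u + p * q)
        * ((vf u * (vf u - u) + p * (1 - u)) + vd * (u * (u - vf u) + q * (1 - vf u))) := by
    ring
  rw [key]
  have hS1 : 0 < p * u + q * vf u + p * q := by positivity
  -- the criterion at the branch point
  have hcrit := wrook_criterion_nonneg p q J (J * (1 - u) + (1 - vf u) + J * q / u - J * q)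
    ((1 - vf u) + J * (1 - u)) u (vf u) hp hq hJ hJ1.le hσ hu0 hvpos
    (by field_simp; ring)
    (by
      have hr := hroot
      rw [hβ u] at hr
      have e : p + (J * (1 - u) + (1 - vf u) + J * q / u - J * q) * J - ((1 - vf u) + J * (1 - u))
          = (1 - J) * vf u + ((p - (1 - J) - J ^ 2 * q - J * (1 - J)) + J ^ 2 * q / u
            + J * (1 - J) * u) := by ring
      rw [e]
      linear_combination hr)
    rfl
  have hs' : 0 < 2 * (1 - J) * vf u + ((p - (1 - J) - J ^ 2 * q - J * (1 - J)) + J ^ 2 * q / u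
      + J * (1 - J) * u) := by rw [← hβ u, hΦv]; exact hspos
  have hr' : (1 - J) * vf u ^ 2 + ((p - (1 - J) - J ^ 2 * q - J * (1 - J)) + J ^ 2 * q / u
      + J * (1 - J) * u) * vf u - p = 0 := by rw [← hβ u]; exact hroot
  have hXY0 := wrook_dir_nonneg hJ hu0 hvpos hs' hr' hcrit
  rw [← hβ u, hΦv] at hXY0
  have hXY : 0 ≤ (vf u * (vf u - u) + p * (1 - u)) + vd * (u * (u - vf u) + q * (1 - vf u)) := by
    rw [hvd]; exact hXY0
  have := mul_nonneg (mul_nonneg (by positivity : (0:ℝ) ≤ 2 * p * q * (p + q + p * q)) hS1.le) hXY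
  simpa [mul_assoc] using this

/-- The coupling along the branch, `σ(u) = J(1-u) + (1 - v(u)) + Jq/u - Jq`, has a negative
derivative at every `u > 0`: `σ′·u²√R = -J (q v² + (u²+q) p) < 0`, using `√R·v = (1-J)v² + p`.
[folklore] -/
theorem wrook_sigma_hasDerivAt {p q J : ℝ} (hq : 1 ≤ q) (hJ : 0 < J) (hJ1 : J < 1) (hp0 : 0 < p)
    (β R vf σf : ℝ → ℝ)
    (hβ : ∀ u, β u = (p - (1 - J) - J ^ 2 * q - J * (1 - J)) + J ^ 2 * q / u + J * (1 - J) * u)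
    (hR : ∀ u, R u = β u ^ 2 + 4 * (1 - J) * p)
    (hvf : ∀ u, vf u = (-β u + Real.sqrt (R u)) / (2 * (1 - J)))
    (hσf : ∀ u, σf u = J * (1 - u) + (1 - vf u) + J * q / u - J * q) {u : ℝ} (hu0 : 0 < u) :
    ∃ σ' : ℝ, HasDerivAt σf σ' u ∧ σ' < 0 := by
  have hq0 : 0 < q := by linarith
  have hune : u ≠ 0 := hu0.ne'
  obtain ⟨_, hspos, hvpos, hΦv, hroot⟩ := wrook_branch_basic hJ1 hp0 β R vf hR hvf u
  have hv' := wrook_branch_hasDerivAt hJ1 hp0 β R vf hβ hR hvf hune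
  set vd : ℝ := -((J * (1 - J) - J ^ 2 * q / u ^ 2) * vf u) / Real.sqrt (R u) with hvd
  have h1 : HasDerivAt (fun u : ℝ => J * (1 - u)) (J * (-1)) u := by
    simpa using ((hasDerivAt_id u).const_sub 1).const_mul J
  have h2 : HasDerivAt (fun u => 1 - vf u) (-vd) u := hv'.const_sub 1
  have h3 : HasDerivAt (fun u : ℝ => J * q / u - J * q) (J * q * (-(u ^ 2)⁻¹)) u := by
    have h := ((hasDerivAt_inv hune).const_mul (J * q)).sub_const (J * q)
    have hfun : (fun u : ℝ => J * q / u - J * q) = fun u => J * q * u⁻¹ - J * q := by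
      funext x; simp only [div_eq_mul_inv]
    rw [hfun]; exact h
  have h := (h1.add h2).add h3
  have hfun : σf = fun u => J * (1 - u) + (1 - vf u) + (J * q / u - J * q) := by
    funext x; rw [hσf x]; ring
  refine ⟨_, by rw [hfun]; exact h, ?_⟩
  -- sign
  have hsv : Real.sqrt (R u) * vf u = (1 - J) * vf u ^ 2 + p := by
    linear_combination (vf u) * hΦv.symm + hroot
  have hsne : Real.sqrt (R u) ≠ 0 := hspos.ne'
  have key : (J * (-1) + -vd + J * q * (-(u ^ 2)⁻¹)) * (u ^ 2 * Real.sqrt (R u) * vf u)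
      = -(J * ((u ^ 2 + q) * (Real.sqrt (R u) * vf u) - ((1 - J) * u ^ 2 - J * q) * vf u ^ 2)) := by
    have e2 : -vd * Real.sqrt (R u) = (J * (1 - J) - J ^ 2 * q / u ^ 2) * vf u := by
      rw [hvd]; field_simp
    have e3 : J * q * (-(u ^ 2)⁻¹) * u ^ 2 = -(J * q) := by field_simp
    have e4 : (J * (1 - J) - J ^ 2 * q / u ^ 2) * u ^ 2 = J * (1 - J) * u ^ 2 - J ^ 2 * q := by
      field_simp
    linear_combination (u ^ 2 * vf u) * e2 + (Real.sqrt (R u) * vf u) * e3 + (vf u * vf u) * e4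
  rw [hsv] at key
  have hpos : 0 < u ^ 2 * Real.sqrt (R u) * vf u := by positivity
  have hneg : (J * (-1) + -vd + J * q * (-(u ^ 2)⁻¹)) * (u ^ 2 * Real.sqrt (R u) * vf u) < 0 := by
    rw [key, neg_lt_zero]
    have e : (u ^ 2 + q) * ((1 - J) * vf u ^ 2 + p) - ((1 - J) * u ^ 2 - J * q) * vf u ^ 2
        = q * vf u ^ 2 + (u ^ 2 + q) * p := by ring
    rw [e]; positivity
  by_contra hc
  exact absurd (mul_nonneg (le_of_not_gt hc) hpos.le) (not_le.mpr hneg)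

/-- `σ` is strictly antitone on `(0,1]` and `σ(1) = 0` (so `σ(u) > 0` on `(0,1)`). [folklore] -/
theorem wrook_sigma_strictAnti {p q J : ℝ} (hq : 1 ≤ q) (hJ : 0 < J) (hJ1 : J < 1) (hp0 : 0 < p)
    (β R vf σf : ℝ → ℝ)
    (hβ : ∀ u, β u = (p - (1 - J) - J ^ 2 * q - J * (1 - J)) + J ^ 2 * q / u + J * (1 - J) * u)
    (hR : ∀ u, R u = β u ^ 2 + 4 * (1 - J) * p)
    (hvf : ∀ u, vf u = (-β u + Real.sqrt (R u)) / (2 * (1 - J)))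
    (hσf : ∀ u, σf u = J * (1 - u) + (1 - vf u) + J * q / u - J * q) :
    StrictAntiOn σf (Set.Ioc 0 1) ∧ σf 1 = 0 := by
  refine ⟨?_, ?_⟩
  · refine strictAntiOn_of_deriv_neg (convex_Ioc 0 1) ?_ ?_
    · exact fun u hu => (wrook_sigma_hasDerivAt hq hJ hJ1 hp0 β R vf σf hβ hR hvf hσf
        hu.1).choose_spec.1.continuousAt.continuousWithinAt
    · intro u hu
      rw [interior_Ioc] at hu
      obtain ⟨σ', h, hneg⟩ := wrook_sigma_hasDerivAt hq hJ hJ1 hp0 β R vf σf hβ hR hvf hσf hu.1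
      rw [h.deriv]; exact hneg
  · have hR1 : R 1 = (p + 1 - J) ^ 2 := by rw [hR, hβ]; ring
    have hs1 : Real.sqrt (R 1) = p + 1 - J := by rw [hR1]; exact Real.sqrt_sq (by linarith)
    have hv1 : vf 1 = 1 := by
      rw [hvf, hs1, hβ]
      have hJ' : (1 : ℝ) - J ≠ 0 := (sub_pos.mpr hJ1).ne'
      field_simp; ring
    rw [hσf, hv1]; ring

/-- **THEOREM R, analytic form** (flat overlap antitone in the coupling).  For real `p, q ≥ 1`,
`0 < J < 1`, two physical points `(uᵢ, vᵢ, Eᵢ)` of the weighted rook quotient at couplings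
`0 < σ₁ ≤ σ₂` (positive solutions of (E1)–(E3)) satisfy `W(u₂,v₂) ≤ W(u₁,v₁)`,
`W(u,v) = (pu + qv + pq)² / ((p + q + pq)(pu² + qv² + pq))` — the two-magnon flat overlap
(`⟨S⁺_tot S⁻_tot⟩` up to a positive affine map) of `K_{p+1} □ K_{q+1}` with direction weights
`1, J` is non-increasing in `σ = 1 - Δ`, i.e. non-decreasing in the anisotropy for all `Δ < 1`.
Proof: `u` parametrises the solution branch; along it `W` is monotone (derivative `∝ T ≥ 0`,
`wrook_criterion_nonneg`) and `σ` strictly antitone (mean value theorem).  Theory seat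
hubbard-h0-rotor-theory-1, ROTOR-THEORY-5 §41 (THEOREM R). [folklore] -/
theorem wrook_flatOverlap_antitone (p q J : ℝ) (hp : 1 ≤ p) (hq : 1 ≤ q) (hJ : 0 < J) (hJ1 : J < 1)
    {σ₁ E₁ u₁ v₁ σ₂ E₂ u₂ v₂ : ℝ} (hσ₁ : 0 < σ₁) (h12 : σ₁ ≤ σ₂)
    (hu₁ : 0 < u₁) (hv₁ : 0 < v₁) (hu₂ : 0 < u₂) (hv₂ : 0 < v₂)
    (a1 : u₁ * (J * q + σ₁ - E₁) = J * q) (a2 : v₁ * (p + σ₁ * J - E₁) = p)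
    (a3 : E₁ = (1 - v₁) + J * (1 - u₁))
    (b1 : u₂ * (J * q + σ₂ - E₂) = J * q) (b2 : v₂ * (p + σ₂ * J - E₂) = p)
    (b3 : E₂ = (1 - v₂) + J * (1 - u₂)) :
    (p * u₂ + q * v₂ + p * q) ^ 2 / ((p + q + p * q) * (p * u₂ ^ 2 + q * v₂ ^ 2 + p * q))
      ≤ (p * u₁ + q * v₁ + p * q) ^ 2 / ((p + q + p * q) * (p * u₁ ^ 2 + q * v₁ ^ 2 + p * q)) := by
  have hp0 : 0 < p := by linarith
  -- the branch functions (explicit lambdas; their defining equations hold by `rfl`)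
  let β : ℝ → ℝ := fun u => (p - (1 - J) - J ^ 2 * q - J * (1 - J)) + J ^ 2 * q / u + J * (1 - J) * u
  let R : ℝ → ℝ := fun u => β u ^ 2 + 4 * (1 - J) * p
  let vf : ℝ → ℝ := fun u => (-β u + Real.sqrt (R u)) / (2 * (1 - J))
  let σf : ℝ → ℝ := fun u => J * (1 - u) + (1 - vf u) + J * q / u - J * q
  let g : ℝ → ℝ := fun u => (p * u + q * vf u + p * q) ^ 2 /
      ((p + q + p * q) * (p * u ^ 2 + q * vf u ^ 2 + p * q))
  have hβ : ∀ u, β u = (p - (1 - J) - J ^ 2 * q - J * (1 - J)) + J ^ 2 * q / u + J * (1 - J) * u :=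
    fun u => rfl
  have hR : ∀ u, R u = β u ^ 2 + 4 * (1 - J) * p := fun u => rfl
  have hvf : ∀ u, vf u = (-β u + Real.sqrt (R u)) / (2 * (1 - J)) := fun u => rfl
  have hσf : ∀ u, σf u = J * (1 - u) + (1 - vf u) + J * q / u - J * q := fun u => rfl
  have hg : ∀ u, g u = (p * u + q * vf u + p * q) ^ 2 /
      ((p + q + p * q) * (p * u ^ 2 + q * vf u ^ 2 + p * q)) := fun u => rfl
  obtain ⟨hσanti, hσ1⟩ := wrook_sigma_strictAnti hq hJ hJ1 hp0 β R vf σf hβ hR hvf hσf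
  have hσpos : ∀ u, 0 < u → u < 1 → 0 < σf u := by
    intro u hu0 hu1
    have := hσanti ⟨hu0, hu1.le⟩ ⟨zero_lt_one, le_rfl⟩ hu1
    rw [hσ1] at this; exact this
  -- `g` is monotone on `(0,1)`
  have hgmono : MonotoneOn g (Set.Ioo 0 1) := by
    refine monotoneOn_of_deriv_nonneg (convex_Ioo 0 1) ?_ ?_ ?_
    · exact fun u hu => (wrook_overlap_hasDerivAt hp hq hJ hJ1 β R vf g hβ hR hvf hg hu.1
        (hσpos u hu.1 hu.2)).choose_spec.1.continuousAt.continuousWithinAt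
    · intro u hu
      rw [interior_Ioo] at hu
      exact (wrook_overlap_hasDerivAt hp hq hJ hJ1 β R vf g hβ hR hvf hg hu.1
        (hσpos u hu.1 hu.2)).choose_spec.1.differentiableAt.differentiableWithinAt
    · intro u hu
      rw [interior_Ioo] at hu
      obtain ⟨g', hg', hnn⟩ := wrook_overlap_hasDerivAt hp hq hJ hJ1 β R vf g hβ hR hvf hg hu.1
        (hσpos u hu.1 hu.2)
      rw [hg'.deriv]; exact hnn
  -- the two physical points lie on the branch
  obtain ⟨_, hu₁1, _⟩ := wrook_ranges hp hq hJ hJ1.le hσ₁ hu₁ hv₁ a1 a2 a3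
  obtain ⟨_, hu₂1, _⟩ := wrook_ranges hp hq hJ hJ1.le (lt_of_lt_of_le hσ₁ h12) hu₂ hv₂ b1 b2 b3
  obtain ⟨r1, s1⟩ := wrook_point_relations hu₁ a1 a2 a3
  obtain ⟨r2, s2⟩ := wrook_point_relations hu₂ b1 b2 b3
  have hb1 := wrook_branch_basic hJ1 hp0 β R vf hR hvf u₁
  have hb2 := wrook_branch_basic hJ1 hp0 β R vf hR hvf u₂
  have hv₁e : v₁ = vf u₁ :=
    wrook_posRoot_unique hJ1 hp0 hv₁ hb1.2.2.1 r1 (by rw [← hβ u₁]; exact hb1.2.2.2.2)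
  have hv₂e : v₂ = vf u₂ :=
    wrook_posRoot_unique hJ1 hp0 hv₂ hb2.2.2.1 r2 (by rw [← hβ u₂]; exact hb2.2.2.2.2)
  have hσ₁e : σ₁ = σf u₁ := by rw [hσf, s1, hv₁e]
  have hσ₂e : σ₂ = σf u₂ := by rw [hσf, s2, hv₂e]
  -- `σ₁ ≤ σ₂` forces `u₂ ≤ u₁`
  have hu21 : u₂ ≤ u₁ := by
    by_contra h
    have h' : u₁ < u₂ := lt_of_not_ge h
    have := hσanti ⟨hu₁, hu₁1.le⟩ ⟨hu₂, hu₂1.le⟩ h'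
    rw [← hσ₁e, ← hσ₂e] at this
    linarith
  have hmain := hgmono ⟨hu₂, hu₂1⟩ ⟨hu₁, hu₁1⟩ hu21
  rw [hg, hg] at hmain
  rw [hv₁e, hv₂e]
  exact hmain

end Summit.HubbardSuperconductivity.HubbardSuperconductivity.Theorems.AnisotropyChord.TwoMagnon
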